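import Summits.RiemannHypothesis.RiemannHypothesis.Theorems.PfPersistenceM2EvenSectorUnconditional
import Summits.RiemannHypothesis.RiemannHypothesis.Theorems.PfPersistenceM2IndexMonotone
import Summits.RiemannHypothesis.RiemannHypothesis.Theorems.PfPersistenceM2EvenSectorIndexDichotomy
import Summits.RiemannHypothesis.RiemannHypothesis.Theorems.PfPersistenceWindowFiniteIndex
import Summits.RiemannHypothesis.RiemannHypothesis.Theorems.HandoffDecomposition
import Summits.RiemannHypothesis.RiemannHypothesis.Theorems.CofiniteCriticalLine.Negative.Reformulations
import HarnessLib

/-!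
# HANDOFF — THE LEDGER READ WITH MULTIPLICITY: negative even directions per prime window (file XIX)

Cell `rh-explicit`, TRACK «HANDOFF» (ROUTE 1′), seat theory-1 (H-T, statement owner), gen17.
HOME `run/shared/lean/pub/rh-explicit/handoff/HANDOFF-STATEMENT.md` §J.32′ / LOGIC-CARD item 4⁗.

HONEST FRAMING. Nothing here bears on the truth of RH. Every statement is a short consequence of tree
theorems of the cell `pub-rhpf` (M2 seat: `PfPersistenceM2EvenSectorIndexExact`,
`PfPersistenceM2EvenSectorUnconditional`, `PfPersistenceM2IndexMonotone`; GAL-7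
`PfPersistenceWindowFiniteIndex`), of route `RuelleBand`'s reformulations
(`CofiniteCriticalLine.Negative.Reformulations`) and of this track's `HandoffDecomposition`,
RE-INDEXED BY PRIME WINDOWS. No definitions.

THE QUESTION (the human, 2026-08-23: «can we use the handoff to generate a conjecture about structure we
can try to prove (which would yield RH)?»). In the SIGN currency the answer of record is RIGIDITY: off RH
the handoff clause `H(q)` (Weil positivity up to `(log q⁺)/2`) fails at every prime from the first failing
one on, the increment fails at most once, and every «for all but finitely many primes» statement is RH
itself or «rung ⟹ RH» (`HandoffFailingStep`, `riemannHypothesis_iff_forall_ge_handoffH`). THIS FILE reads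
the same ledger WITH MULTIPLICITY: «level `n` is reached at `t`» is pub-rhpf's `EvenNegIndexAtLeast n t`
(there are `n` even real Weil tests supported in `[-t, t]` on whose real span `Re Q` is negative definite),
and `𝒬 = {ρ : ζ(ρ) = 0 non-trivial, Re ρ > 1/2, Im ρ > 0}`, `K = #𝒬 ∈ ℕ ∪ {∞}` (`Set.encard`). Kernel:

* §1 prime windows are cofinal: a level is reached on some window iff on some prime window
  (`exists_evenNegIndexAtLeast_iff_exists_prime`); level `0` is free (pub-rhpf's `evenNegIndexAtLeast_zero`).
* §2 LEVEL ONE OF THE LEDGER IS THE SIGN LEDGER: a passed handoff `H(q)` leaves no level at its window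
  (`not_evenNegIndexAtLeast_succ_of_handoffH`, from pub-rhpf's `not_evenNegIndexAtLeast_succ_of_weilPositivityOn`;
  theorem rung `(log 3)/2`: `not_evenNegIndexAtLeast_succ_log_three_half`); off RH every long window
  carries level `1` (pub-rhpf's `evenNegIndexAtLeast_one_of_not_riemannHypothesis`); hence
  `RH ⟺ ∀ q prime, no level at (log q⁺)/2` (`riemannHypothesis_iff_forall_prime_not_evenNegIndexAtLeast_one`,
  `…_succ`).
* §3 THE GRADED LEDGER COUNTS THE EXCEPTIONAL QUADRUPLES, for every `K ∈ ℕ ∪ {∞}`: level `n` is reached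
  in some prime window iff `n ≤ K` (`exists_prime_evenNegIndexAtLeast_iff_le_encard`); level `n + 1` in
  NO prime window iff `K ≤ n` (`forall_prime_not_evenNegIndexAtLeast_succ_iff_encard_le`) — one even
  negative direction per quadruple `{ρ, ρ̄, 1−ρ, 1−ρ̄}` (pub-rhpf's count, Bombieri 2000 Thm 9 window-uniform).
* §4 THE FROZEN LEDGER («no prime window from `Q` on adds a direction»; written out as a hypothesis,
  no definition): every level ever reached is visible at `(log Q)/2` (`evenNegIndexAtLeast_of_frozen`),
  so, UNCONDITIONALLY, `K ≤ 4·L((log Q)/2) + 4` with GAL-7's explicit window level `L`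
  (`encard_le_of_frozen`, `quadrant_finite_of_frozen`); conversely `K < ∞` freezes the ledger from some
  prime (`exists_prime_frozen_of_finite`). HEADLINE (`exists_prime_frozen_iff_cofiniteCriticalLine`):
  **«the ledger is frozen from SOME prime» ⟺ route RuelleBand's crux `CofiniteCriticalLine`** (all but
  finitely many non-trivial zeros on the line, item stmt-RiemannHypothesis-2064).
* §5 RH READINGS: `RH ⟺ (frozen from Q) ∧ (no level at (log Q)/2)` for every `Q`
  (`riemannHypothesis_iff_frozen_and_not_evenNegIndexAtLeast_one`, the index twin of
  `forall_ge_handoffStep_iff`), and with the tree's theorem rung `H(2)`: **`RH ⟺ the ledger is frozen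
  from 3`** (`riemannHypothesis_iff_frozen_three`).

READING (LOGIC-CARD 4⁗). In the sign currency «all but finitely many primes are inert» is RH; in the
index currency it is EXACTLY the cofinite critical line — the one tail statement in handoff coordinates
that is a named crux of the tree BELOW RH (RH implies it, `exists_prime_frozen_iff_cofiniteCriticalLine` with
`riemannHypothesis_iff_frozen_three`; it is not known to imply RH), graded by `Q`: frozen from `Q` ⟹ at
most `4·L((log Q)/2) + 4` exceptional quadruples; frozen from `3` ⟺ RH. Partial
structure = partial RH in a third currency (sign ↔ RH; loss rate ↔ zero-free strip width, files VI–IX;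
index ↔ NUMBER of exceptional quadruples), the per-prime entries being finite-`S` objects by locality in
each. No door: the rung at `(log Q)/2` is what separates «frozen from Q» from RH, and that rung is RH's
residue exactly as in the sign currency.

References: Bombieri 2000 (Rend. Lincei (9) 11) Thms 2, 8, 9, 11 [cite: Bombieri2000Weil, Thm 9];
Yoshida 1992 [cite: Yoshida1992HermitianForms, Thm 1, Prop. 1]; this track's HANDOFF-STATEMENT §B, §J.13, §J.32′.
-/

set_option linter.dupNamespace false  -- the mandated namespace repeats `RiemannHypothesis`

noncomputable section

open Set Filter
open Literature.NumberTheory.LFunctions Literature.NumberTheory.LFunctions.ZetaZeros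
open Summit.RiemannHypothesis.RiemannHypothesis.Theorems.PfPersistenceM2NegIndex
open Summit.RiemannHypothesis.RiemannHypothesis.Theorems.PfPersistence (windowLevel evenNegIndexAtLeast_le)
open Summit.RiemannHypothesis.RiemannHypothesis.Theorems.HandoffDecomposition
open Summit.RiemannHypothesis.RiemannHypothesis.Theorems.PfPersistenceParityIndex
  (evenNegIndexAtLeast_one_of_not_riemannHypothesis)
open Summit.RiemannHypothesis.RiemannHypothesis.Theses.RuelleBand (CofiniteCriticalLine)
open Summit.RiemannHypothesis.Cruxes.CofiniteCriticalLine.Negative (cofiniteCriticalLine_iff_quadrant_finite)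

namespace Summit.RiemannHypothesis.RiemannHypothesis.Theorems.HandoffIndexLedger

/-! ## §1 Prime windows are cofinal -/

/-- For every `a` and `Q` there is a prime `q ≥ Q` whose window `[-(log q)/2, (log q)/2]` contains
`[-a, a]`. [folklore] -/
theorem exists_prime_ge_le_log_half (a : ℝ) (Q : ℕ) :
    ∃ q : ℕ, q.Prime ∧ Q ≤ q ∧ a ≤ Real.log q / 2 := by
  obtain ⟨q, hq, hp⟩ := Nat.exists_infinite_primes (max Q ⌈Real.exp (2 * a)⌉₊)
  refine ⟨q, hp, (le_max_left _ _).trans hq, ?_⟩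
  have h1 : Real.exp (2 * a) ≤ q :=
    (Nat.le_ceil _).trans (by exact_mod_cast (le_max_right _ _).trans hq)
  have h2 : 2 * a ≤ Real.log q :=
    (Real.le_log_iff_exp_le (by exact_mod_cast hp.pos)).2 h1
  linarith

/-- `(log q)/2 ≤ (log q⁺)/2`. [folklore] -/
theorem log_half_le_log_nextPrime_half {q : ℕ} (hq : q.Prime) :
    Real.log q / 2 ≤ Real.log (nextPrime q) / 2 := by
  have := Real.log_le_log (by exact_mod_cast hq.pos : (0 : ℝ) < q)
    (by exact_mod_cast (lt_nextPrime q).le : (q : ℝ) ≤ nextPrime q)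
  linarith

/-- **Re-indexing by primes.** A level reached on some window is reached on some prime window (and
conversely), by monotonicity in the window. [folklore] -/
theorem exists_evenNegIndexAtLeast_iff_exists_prime (n : ℕ) :
    (∃ a : ℝ, EvenNegIndexAtLeast n a) ↔ ∃ q : ℕ, q.Prime ∧ EvenNegIndexAtLeast n (Real.log q / 2) := by
  constructor
  · rintro ⟨a, ha⟩
    obtain ⟨q, hq, -, hle⟩ := exists_prime_ge_le_log_half a 0
    exact ⟨q, hq, ha.mono hle⟩
  · rintro ⟨q, -, h⟩
    exact ⟨_, h⟩

/-! ## §2 Level one of the ledger is the sign ledger -/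

/-- **A passed handoff adds no direction**: `H(q)` (Weil positivity up to `(log q⁺)/2`,
`handoffH_iff_weilPositivityOn`) leaves no level at the window of `q`. [cite: Bombieri2000Weil, §4] -/
theorem not_evenNegIndexAtLeast_succ_of_handoffH {q : ℕ} (hq : q.Prime) (h : HandoffH q) (n : ℕ) :
    ¬ EvenNegIndexAtLeast (n + 1) (Real.log (nextPrime q) / 2) :=
  not_evenNegIndexAtLeast_succ_of_weilPositivityOn ((handoffH_iff_weilPositivityOn hq).1 h) n

/-- **The theorem rung of the ledger**: no level at `(log 3)/2` (`handoffH_two`, Yoshida's theorem).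
[cite: Yoshida1992HermitianForms, Thm 1] -/
theorem not_evenNegIndexAtLeast_succ_log_three_half (n : ℕ) :
    ¬ EvenNegIndexAtLeast (n + 1) (Real.log 3 / 2) := by
  have h := not_evenNegIndexAtLeast_succ_of_handoffH Nat.prime_two handoffH_two n
  rw [nextPrime_two] at h
  exact_mod_cast h

/-- **LEVEL ONE OF THE LEDGER IS THE SIGN LEDGER**: `RH ⟺` no prime window `(log q⁺)/2` carries an even
negative direction — the handoff criterion `riemannHypothesis_iff_forall_handoffH` read in index language
(even sector). [cite: Bombieri2000Weil, Thm 2, Thm 9] -/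
theorem riemannHypothesis_iff_forall_prime_not_evenNegIndexAtLeast_one :
    RiemannHypothesis ↔ ∀ q : ℕ, q.Prime → ¬ EvenNegIndexAtLeast 1 (Real.log (nextPrime q) / 2) := by
  refine ⟨fun h q _ ↦ not_evenNegIndexAtLeast_succ_of_riemannHypothesis h 0 _, fun h ↦ ?_⟩
  by_contra hRH
  obtain ⟨A, hA⟩ := evenNegIndexAtLeast_one_of_not_riemannHypothesis hRH
  obtain ⟨q, hq, -, hle⟩ := exists_prime_ge_le_log_half A 0
  exact h q hq ((hA _ le_rfl).mono (hle.trans (log_half_le_log_nextPrime_half hq)))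

/-- The whole ledger is empty under RH and only then: `RH ⟺` no prime window reaches any level `≥ 1`.
[cite: Bombieri2000Weil, Thm 2] -/
theorem riemannHypothesis_iff_forall_prime_not_evenNegIndexAtLeast_succ :
    RiemannHypothesis ↔
      ∀ q : ℕ, q.Prime → ∀ n : ℕ, ¬ EvenNegIndexAtLeast (n + 1) (Real.log (nextPrime q) / 2) := by
  rw [riemannHypothesis_iff_forall_prime_not_evenNegIndexAtLeast_one]
  exact ⟨fun h q hq n hn ↦ h q hq (hn.of_le (by omega)), fun h q hq ↦ h q hq 0⟩

/-! ## §3 The graded ledger counts the exceptional quadruples (`K ∈ ℕ ∪ {∞}`) -/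

/-- **Level `n` is reached in some prime window iff `n ≤ K`** (`K = #𝒬 ∈ ℕ ∪ {∞}`, pub-rhpf's
unconditional count `exists_evenNegIndexAtLeast_iff_encard`, re-indexed). [cite: Bombieri2000Weil, Thm 9 (even part); Thm 11] -/
theorem exists_prime_evenNegIndexAtLeast_iff_le_encard (n : ℕ) :
    (∃ q : ℕ, q.Prime ∧ EvenNegIndexAtLeast n (Real.log q / 2)) ↔
      (n : ℕ∞) ≤ {ρ : ℂ | ρ ∈ riemannZetaNontrivialZeros ∧ 1 / 2 < ρ.re ∧ 0 < ρ.im}.encard := by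
  rw [← exists_evenNegIndexAtLeast_iff_exists_prime]
  exact exists_evenNegIndexAtLeast_iff_encard n

/-- **Level `n + 1` in NO prime window iff `K ≤ n`**, unconditionally. Only `n = 0` is RH.
[cite: Bombieri2000Weil, Thm 9 (even part); Thm 11] -/
theorem forall_prime_not_evenNegIndexAtLeast_succ_iff_encard_le (n : ℕ) :
    (∀ q : ℕ, q.Prime → ¬ EvenNegIndexAtLeast (n + 1) (Real.log (nextPrime q) / 2)) ↔
      {ρ : ℂ | ρ ∈ riemannZetaNontrivialZeros ∧ 1 / 2 < ρ.re ∧ 0 < ρ.im}.encard ≤ n := by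
  constructor
  · intro h
    by_contra hlt
    have hle : ((n + 1 : ℕ) : ℕ∞) ≤
        {ρ : ℂ | ρ ∈ riemannZetaNontrivialZeros ∧ 1 / 2 < ρ.re ∧ 0 < ρ.im}.encard := by
      push_cast
      exact Order.add_one_le_of_lt (not_le.1 hlt)
    obtain ⟨a, ha⟩ := (exists_evenNegIndexAtLeast_iff_encard (n + 1)).2 hle
    obtain ⟨q, hq, -, hqa⟩ := exists_prime_ge_le_log_half a 0
    exact h q hq (ha.mono (hqa.trans (log_half_le_log_nextPrime_half hq)))
  · intro h q _ hq
    have h1 := (exists_evenNegIndexAtLeast_iff_encard (n + 1)).1 ⟨_, hq⟩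
    have h2 : ((n + 1 : ℕ) : ℕ∞) ≤ n := h1.trans h
    have h3 : n + 1 ≤ n := by exact_mod_cast h2
    omega

/-! ## §4 The frozen ledger: «no prime window from `Q` on adds a direction» -/

/-- **Every level ever reached is visible at `(log Q)/2`** when the ledger is frozen from `Q`. [folklore] -/
theorem evenNegIndexAtLeast_of_frozen {Q : ℕ}
    (hfrozen : ∀ q : ℕ, q.Prime → Q ≤ q → ∀ n : ℕ,
      EvenNegIndexAtLeast n (Real.log q / 2) → EvenNegIndexAtLeast n (Real.log Q / 2))
    {n : ℕ} {a : ℝ} (h : EvenNegIndexAtLeast n a) : EvenNegIndexAtLeast n (Real.log Q / 2) := by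
  obtain ⟨q, hq, hQq, hle⟩ := exists_prime_ge_le_log_half a Q
  exact hfrozen q hq hQq n (h.mono hle)

/-- **A frozen ledger bounds the number of exceptional quadruples, unconditionally**: if no prime window
from `Q ≥ 2` on adds an even negative direction, then `K ≤ 4·L((log Q)/2) + 4`, with `L` = GAL-7's
explicit window level `PfPersistence.windowLevel` (Yoshida's finiteness of the index on a fixed window).
[cite: Bombieri2000Weil, Thm 9, Thm 11; Yoshida1992HermitianForms, Lemma 3] -/
theorem encard_le_of_frozen {Q : ℕ} (hQ : 2 ≤ Q)
    (hfrozen : ∀ q : ℕ, q.Prime → Q ≤ q → ∀ n : ℕ,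
      EvenNegIndexAtLeast n (Real.log q / 2) → EvenNegIndexAtLeast n (Real.log Q / 2)) :
    {ρ : ℂ | ρ ∈ riemannZetaNontrivialZeros ∧ 1 / 2 < ρ.re ∧ 0 < ρ.im}.encard ≤
      (4 * windowLevel (Real.log Q / 2) + 4 : ℕ) := by
  have hpos : 0 < Real.log Q / 2 := by
    have h1 : (1 : ℝ) < Q := by exact_mod_cast lt_of_lt_of_le one_lt_two hQ
    have := Real.log_pos h1
    linarith
  rw [← forall_prime_not_evenNegIndexAtLeast_succ_iff_encard_le]
  intro q _ hq
  have := evenNegIndexAtLeast_le hpos (evenNegIndexAtLeast_of_frozen hfrozen hq)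
  omega

/-- Hence a frozen ledger forces finitely many exceptional quadruples. [cite: Bombieri2000Weil, Thm 11] -/
theorem quadrant_finite_of_frozen {Q : ℕ} (hQ : 2 ≤ Q)
    (hfrozen : ∀ q : ℕ, q.Prime → Q ≤ q → ∀ n : ℕ,
      EvenNegIndexAtLeast n (Real.log q / 2) → EvenNegIndexAtLeast n (Real.log Q / 2)) :
    {ρ : ℂ | ρ ∈ riemannZetaNontrivialZeros ∧ 1 / 2 < ρ.re ∧ 0 < ρ.im}.Finite :=
  Set.finite_of_encard_le_coe (encard_le_of_frozen hQ hfrozen)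

/-- **Finite case: frozen from `Q` iff all `K` directions are visible at `(log Q)/2`.**
[cite: Bombieri2000Weil, Thm 9 (even part)] -/
theorem frozen_iff_evenNegIndexAtLeast_card
    (hfin : {ρ : ℂ | ρ ∈ riemannZetaNontrivialZeros ∧ 1 / 2 < ρ.re ∧ 0 < ρ.im}.Finite) (Q : ℕ) :
    (∀ q : ℕ, q.Prime → Q ≤ q → ∀ n : ℕ,
        EvenNegIndexAtLeast n (Real.log q / 2) → EvenNegIndexAtLeast n (Real.log Q / 2)) ↔
      EvenNegIndexAtLeast hfin.toFinset.card (Real.log Q / 2) := by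
  constructor
  · intro hfrozen
    obtain ⟨A, hA⟩ := evenNegIndexAtLeast_of_finite hfin le_rfl
    exact evenNegIndexAtLeast_of_frozen hfrozen (hA A le_rfl)
  · intro hK q _ _ n hn
    have hle : n ≤ hfin.toFinset.card := by
      have := le_encard_quadrant_of_evenNegIndexAtLeast hn
      rw [hfin.encard_eq_coe_toFinset_card] at this
      exact_mod_cast this
    exact hK.of_le hle

/-- **Finitely many exceptional quadruples freeze the ledger from some prime.**
[cite: Bombieri2000Weil, Thm 9 (even part); Thm 11] -/
theorem exists_prime_frozen_of_finite
    (hfin : {ρ : ℂ | ρ ∈ riemannZetaNontrivialZeros ∧ 1 / 2 < ρ.re ∧ 0 < ρ.im}.Finite) :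
    ∃ Q : ℕ, Q.Prime ∧ ∀ q : ℕ, q.Prime → Q ≤ q → ∀ n : ℕ,
      EvenNegIndexAtLeast n (Real.log q / 2) → EvenNegIndexAtLeast n (Real.log Q / 2) := by
  obtain ⟨A, hA⟩ := evenNegIndexAtLeast_of_finite hfin le_rfl
  obtain ⟨Q, hQ, -, hle⟩ := exists_prime_ge_le_log_half A 0
  exact ⟨Q, hQ, (frozen_iff_evenNegIndexAtLeast_card hfin Q).2 ((hA A le_rfl).mono hle)⟩

/-- The two descriptions of the open quadrant agree (non-trivial zeros lie in the open strip,
`mem_riemannZetaNontrivialZeros_iff_holds`). [folklore] -/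
theorem quadrant_eq :
    {ρ : ℂ | ρ ∈ riemannZetaNontrivialZeros ∧ 1 / 2 < ρ.re ∧ 0 < ρ.im} =
      {s : ℂ | riemannZeta s = 0 ∧ 1 / 2 < s.re ∧ s.re < 1 ∧ 0 < s.im} := by
  ext s
  simp only [mem_setOf_eq]
  constructor
  · rintro ⟨hs, h1, h2⟩
    obtain ⟨hz, -, hlt⟩ := mem_riemannZetaNontrivialZeros_iff_holds.1 hs
    exact ⟨hz, h1, hlt, h2⟩
  · rintro ⟨hz, h1, hlt, h2⟩
    exact ⟨mem_riemannZetaNontrivialZeros_iff_holds.2 ⟨hz, by linarith, hlt⟩, h1, h2⟩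

/-- **HEADLINE — «the ledger is frozen from SOME prime» ⟺ `CofiniteCriticalLine`** (route RuelleBand's
crux, item stmt-RiemannHypothesis-2064: all but finitely many non-trivial zeros of `ζ` on the critical
line). In the SIGN currency the corresponding tail statement is RH itself
(`riemannHypothesis_iff_forall_ge_handoffH`); in the INDEX currency it is the cofinite critical line.
[cite: Bombieri2000Weil, Thm 9, Thm 11] -/
theorem exists_prime_frozen_iff_cofiniteCriticalLine :
    (∃ Q : ℕ, Q.Prime ∧ ∀ q : ℕ, q.Prime → Q ≤ q → ∀ n : ℕ,
        EvenNegIndexAtLeast n (Real.log q / 2) → EvenNegIndexAtLeast n (Real.log Q / 2)) ↔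
      CofiniteCriticalLine := by
  rw [cofiniteCriticalLine_iff_quadrant_finite, ← quadrant_eq]
  refine ⟨fun ⟨Q, hQ, hfrozen⟩ ↦ quadrant_finite_of_frozen hQ.two_le hfrozen, fun hfin ↦ ?_⟩
  exact exists_prime_frozen_of_finite hfin

/-! ## §5 RH readings of the frozen ledger -/

/-- **`RH ⟺ (frozen from Q) ∧ (no level at (log Q)/2)`**, for every `Q` — the index twin of the
sign-currency `forall_ge_handoffStep_iff` («a tail of increments is worth exactly rung ⟹ RH»): a frozen
ledger is worth exactly «clean rung ⟹ RH». [cite: Bombieri2000Weil, Thm 2, Thm 9] -/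
theorem riemannHypothesis_iff_frozen_and_not_evenNegIndexAtLeast_one (Q : ℕ) :
    RiemannHypothesis ↔
      (∀ q : ℕ, q.Prime → Q ≤ q → ∀ n : ℕ,
          EvenNegIndexAtLeast n (Real.log q / 2) → EvenNegIndexAtLeast n (Real.log Q / 2)) ∧
        ¬ EvenNegIndexAtLeast 1 (Real.log Q / 2) := by
  constructor
  · intro hRH
    refine ⟨fun q _ _ n hn ↦ ?_, not_evenNegIndexAtLeast_succ_of_riemannHypothesis hRH 0 _⟩
    cases n with
    | zero => exact evenNegIndexAtLeast_zero _
    | succ k => exact absurd hn (not_evenNegIndexAtLeast_succ_of_riemannHypothesis hRH k _)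
  · rintro ⟨hfrozen, hrung⟩
    by_contra hRH
    obtain ⟨A, hA⟩ := evenNegIndexAtLeast_one_of_not_riemannHypothesis hRH
    exact hrung (evenNegIndexAtLeast_of_frozen hfrozen (hA A le_rfl))

/-- **`RH ⟺ the ledger is frozen from 3`** (the rung at `(log 3)/2` is the tree's theorem `handoffH_two`):
no prime window from `3` on adds an even negative direction iff RH. Compare
`exists_prime_frozen_iff_cofiniteCriticalLine`: «from SOME prime» is the cofinite critical line, «from 3»
is RH. [cite: Yoshida1992HermitianForms, Thm 1] -/
theorem riemannHypothesis_iff_frozen_three :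
    RiemannHypothesis ↔
      ∀ q : ℕ, q.Prime → 3 ≤ q → ∀ n : ℕ,
        EvenNegIndexAtLeast n (Real.log q / 2) → EvenNegIndexAtLeast n (Real.log 3 / 2) := by
  have h := riemannHypothesis_iff_frozen_and_not_evenNegIndexAtLeast_one 3
  have h3 := not_evenNegIndexAtLeast_succ_log_three_half 0
  push_cast at h
  exact h.trans ⟨fun hh ↦ hh.1, fun hh ↦ ⟨hh, h3⟩⟩

end Summit.RiemannHypothesis.RiemannHypothesis.Theorems.HandoffIndexLedger
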